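import Literature.AlgebraicGeometry.HodgeTheory.HyperplaneSectionMonodromyTrivialisations
import Literature.AlgebraicGeometry.Motives.ComplexPointsEhresmann
import Literature.AlgebraicGeometry.Motives.GoodReductionSpecialFibreProofs
import Literature.AlgebraicGeometry.Motives.GeometricallyIntegralAlgClosed
import Literature.NumberTheory.Transcendental.AnalytificationConnected
import Literature.NumberTheory.Transcendental.AnalytificationSecondCountableProofs
import HarnessLib

/-!
# The monodromy package of the universal hyperplane section: reduction to smoothness of `π` near `U`

Family `hodge`, layer `Literature/AlgebraicGeometry/HodgeTheory`. Third proof file towards the named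
fact `nonempty_universalHyperplaneSectionLocalSystem` (`HodgeTheory/HyperplaneSectionMonodromy`).
`HyperplaneSectionMonodromyTrivialisations` reduced the fact to: `U` open, and Ehresmann-type local
topological trivialisations of `π(ℂ)` over `U` (`π : 𝒳 ⟶ (ℙᴺ)^*` the universal hyperplane section,
`U` the locus of smooth `n`-dimensional hyperplane sections). Ehresmann's theorem on complex points
is now PROVED in the tree (`Motives/ComplexPointsEhresmann`:
`exists_trivialisation_of_smoothOfRelativeDimension_morphismRestrict`, Voisin I Thm. 9.3 via the
tree's `ehresmann_fibration_holds`), so this file reduces the fact to the purely scheme-theoretic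
statement that `π` is smooth of relative dimension `n` over a Zariski neighbourhood of every point of
`U` — "by the definition of `U`, the map `φ = pr₂` is a submersion with smooth fibre `X_H` over `H`"
(Voisin II §3.2.2):

* `smoothOfRelativeDimension_fiberOver_hom` — fibres over rational points of an open of the base over
  which the family is smooth of relative dimension `n` are smooth of relative dimension `n` (base
  change); `isProjectiveOver_fiberOver` — rational fibres of a projective family over a separated base
  are projective;
* `geometricallyIrreducible_of_connectedSpace_complexPoints` — **a smooth `ℂ`-scheme with connected
  complex points is geometrically irreducible** (SGA1 XII Prop. 2.4 + regular local rings are domains +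
  Görtz–Wedhorn I Ex. 3.16, Prop. 5.51, all PROVED in the tree);
* `fibreHomeomorphOfTrivialisation` — in a family trivial over `V` all fibres over `V` are homeomorphic
  to the model fibre;
* `nonempty_universalHyperplaneSectionLocalSystem_of_smoothOfRelativeDimension_morphismRestrict` —
  **the named fact follows from: every `t ∈ U` has a Zariski-open `V₀ ∋ t` with `π|_{V₀}` smooth of
  relative dimension `n`**. Openness of `U` is part of the conclusion: over the trivialising
  neighbourhood `V ⊆ V₀(ℂ)` of `t` every fibre is smooth (base change), projective, and geometrically
  irreducible because its complex points are homeomorphic to `X_t(ℂ)`, which is connected.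

What remains for `nonempty_universalHyperplaneSectionLocalSystem_holds`: that hypothesis, i.e. the
Jacobian criterion for `π` near a smooth hyperplane section (`𝒳` is a `ℙᴺ⁻¹`-bundle over the smooth
`X`; in the affine charts of `Motives/UniversalHyperplaneSectionChart` it is the graph
`Spec Γ(X, X')[aᵢ/a_l : i ≠ j, l]`).

## References

* [VoisinHodgeII2003] C. Voisin, Hodge Theory and Complex Algebraic Geometry II, CUP 2003, §3.2.2.
* [VoisinHodgeI2002] C. Voisin, Hodge Theory and Complex Algebraic Geometry I, CUP 2002, Thm. 9.3,
  §9.2.1.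
* [Hartshorne1977] R. Hartshorne, Algebraic Geometry, II Ex. 4.9, III Prop. 10.1 (b).
* [SGA1] A. Grothendieck, M. Raynaud, SGA 1, Exp. XII Prop. 2.4.
* [GortzWedhorn2020] U. Görtz, T. Wedhorn, Algebraic Geometry I, Exercise 3.16, Prop. 5.51.
-/

noncomputable section

open CategoryTheory AlgebraicGeometry Limits
open _root_.Topology _root_.Filter

universe u

namespace Literature.AlgebraicGeometry.Motives

/-! ### Fibres over points of an open of the base where the family is smooth -/

section Fibres

variable {k : Type u} [Field k] {𝒳 S : SchemeOver k} (π : 𝒳 ⟶ S)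

/-- The structure map `Spec k → Spec k` of `specOver k k` is an isomorphism (it is `Spec` of the
identity). [folklore] -/
theorem isIso_specOver_self_hom : IsIso (specOver k k).hom := by
  change IsIso (Spec.map (CommRingCat.ofHom (algebraMap k k)))
  rw [Algebra.algebraMap_self, CommRingCat.ofHom_id, Spec.map_id]
  infer_instance

/-- A `k`-rational point `s : Spec k → S` of a separated `k`-scheme is a closed immersion (a
section of the separated structure map). [folklore] -/
theorem isClosedImmersion_left_of_algPoints [IsSeparated S.hom] (s : AlgPoints S k) :
    IsClosedImmersion s.left := by
  haveI := isIso_specOver_self_hom (k := k)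
  haveI : IsClosedImmersion (s.left ≫ S.hom) := by
    rw [Over.w s]
    infer_instance
  exact IsClosedImmersion.of_comp s.left S.hom

/-- The fibre inclusion `𝒳_s ⟶ 𝒳` over a rational point of a separated base is a closed immersion
(base change of the closed point `Spec k → S`). [folklore] -/
theorem isClosedImmersion_fiberι_left [IsSeparated S.hom] (s : AlgPoints S k) :
    IsClosedImmersion (fiberι π s).left := by
  haveI := isClosedImmersion_left_of_algPoints s
  rw [fiberι_left]
  exact MorphismProperty.pullback_fst (P := @IsClosedImmersion) _ _ inferInstance

/-- **Fibres of a projective family are projective**: if `𝒳` is projective over `k` and `S` is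
separated over `k`, every rational fibre `𝒳_s` is projective over `k` (`𝒳_s ↪ 𝒳 ↪ ℙᵐ`).
[cite: Hartshorne1977, II Ex. 4.9] -/
theorem isProjectiveOver_fiberOver [IsSeparated S.hom] (h𝒳 : IsProjectiveOver 𝒳) (s : AlgPoints S k) :
    IsProjectiveOver (fiberOver π s) := by
  obtain ⟨m, κ, hκ⟩ := h𝒳
  haveI := isClosedImmersion_fiberι_left π s
  exact ⟨m, fiberι π s ≫ κ, by rw [Over.comp_left]; infer_instance⟩

/-- **Fibres over the smooth locus are smooth**: if `π` is smooth of relative dimension `n` over an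
open `V₀ ⊆ S`, the fibre `𝒳_s` over a rational point `s` of `V₀` is smooth over `k` of relative
dimension `n` (base change of `π|_{V₀}` along `Spec k → V₀`; Hartshorne III Prop. 10.1 (b)).
[cite: Hartshorne1977, III Prop. 10.1 (b)] -/
theorem smoothOfRelativeDimension_fiberOver_hom {n : ℕ} (V₀ : S.left.Opens)
    [hV₀ : SmoothOfRelativeDimension n (π.left ∣_ V₀)] (s : AlgPoints S k) (hs : s.pt ∈ V₀) :
    SmoothOfRelativeDimension n (fiberOver π s).hom := by
  haveI := smoothOfRelativeDimension_isStableUnderBaseChange (n := n)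
  -- `s` factors through `V₀`
  haveI : Subsingleton (specOver k k).left := inferInstanceAs (Subsingleton (Spec (.of k)))
  have hrange : Set.range s.left ⊆ (V₀ : Set S.left) := by
    rintro _ ⟨x, rfl⟩
    have hx : x = IsLocalRing.closedPoint k := Subsingleton.elim _ _
    rw [hx, ← AlgPoints.pt_eq_apply_closedPoint]
    exact hs
  set s' := IsOpenImmersion.lift V₀.ι s.left (by rwa [Scheme.Opens.range_ι]) with hs'
  have hfac : s' ≫ V₀.ι = s.left := IsOpenImmersion.lift_fac _ _ _
  -- smoothness of `pullback.snd π V₀.ι = ≅ ≫ π|_{V₀}`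
  have h1 : SmoothOfRelativeDimension n (pullback.snd π.left V₀.ι) := by
    rw [← pullbackRestrictIsoRestrict_hom_morphismRestrict]
    exact (MorphismProperty.cancel_left_of_respectsIso (@SmoothOfRelativeDimension n) _ _).2 hV₀
  have h2 : SmoothOfRelativeDimension n (pullback.snd (pullback.snd π.left V₀.ι) s') :=
    MorphismProperty.pullback_snd (P := @SmoothOfRelativeDimension n) _ _ h1
  have h3 : ∀ g : (specOver k k).left ⟶ S.left, g = s' ≫ V₀.ι →
      SmoothOfRelativeDimension n (pullback.snd π.left g) := by
    rintro _ rfl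
    have he : pullback.snd π.left (s' ≫ V₀.ι) =
        (pullbackLeftPullbackSndIso π.left V₀.ι s').inv ≫ pullback.snd (pullback.snd π.left V₀.ι) s' := by
      rw [Iso.eq_inv_comp, pullbackLeftPullbackSndIso_hom_snd]
    rw [he]
    exact (MorphismProperty.cancel_left_of_respectsIso (@SmoothOfRelativeDimension n) _ _).2 h2
  haveI h4 : SmoothOfRelativeDimension n (pullback.snd π.left s.left) := h3 _ hfac.symm
  haveI := isIso_specOver_self_hom (k := k)
  rw [fiberOver_hom]
  have h5 : SmoothOfRelativeDimension (n + 0) (pullback.snd π.left s.left ≫ (specOver k k).hom) :=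
    inferInstance
  exact h5

end Fibres

/-! ### Smooth `ℂ`-schemes with connected complex points are geometrically irreducible -/

/-- **Smooth + connected complex points ⇒ geometrically irreducible.** A `ℂ`-scheme `Y` smooth of
relative dimension `n` whose space of complex points `Y(ℂ)` is connected is geometrically
irreducible over `ℂ`: `Y` is connected (the closed points are dense, SGA1 XII Prop. 2.4 — the
tree's `ComplexPoints.connectedSpace_left_of_connectedSpace`), its local rings are domains (Stacks
056S, `isDomain_stalk_of_smoothOfRelativeDimension`), so it is irreducible
(`irreducibleSpace_of_isDomain_stalk`, Görtz–Wedhorn I Ex. 3.16) and reduced, i.e. integral, hence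
geometrically integral over the algebraically closed field `ℂ` (`geometricallyIntegral_of_isAlgClosed`,
Görtz–Wedhorn I Prop. 5.51). [cite: SGA1, Exp. XII Prop. 2.4] [cite: GortzWedhorn2020, Exercise 3.16 and Prop. 5.51] -/
theorem geometricallyIrreducible_of_connectedSpace_complexPoints {Y : SchemeOver ℂ} (n : ℕ)
    [SmoothOfRelativeDimension n Y.hom] [ConnectedSpace (ComplexPoints Y)] :
    GeometricallyIrreducible Y.hom := by
  haveI : Smooth Y.hom := SmoothOfRelativeDimension.smooth n _
  haveI : LocallyOfFiniteType Y.hom := inferInstance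
  haveI : ConnectedSpace Y.left := ComplexPoints.connectedSpace_left_of_connectedSpace (X := Y)
  haveI : IsReduced Y.left := isReduced_of_smoothOfRelativeDimension Y.hom n
  haveI : IsLocallyNoetherian Y.left := LocallyOfFiniteType.isLocallyNoetherian Y.hom
  haveI : IrreducibleSpace Y.left :=
    irreducibleSpace_of_isDomain_stalk Y.left fun x ↦ isDomain_stalk_of_smoothOfRelativeDimension Y.hom n x
  haveI : IsIntegral Y.left := isIntegral_of_irreducibleSpace_of_isReduced Y.left
  haveI := geometricallyIntegral_of_isAlgClosed Y.hom
  infer_instance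

/-! ### Fibres of a trivial family are homeomorphic -/

/-- In a family `p : E → B` trivial over `V` (`φ : V × F ≃ p⁻¹(V)` over `V`), the fibre over every
`s ∈ V` is homeomorphic to `F`. [folklore] -/
def fibreHomeomorphOfTrivialisation {E B F : Type*} [TopologicalSpace E] [TopologicalSpace B]
    [TopologicalSpace F] {p : E → B} {V : Set B} (φ : V × F ≃ₜ (p ⁻¹' V))
    (hφ : ∀ x, p (φ x) = x.1) {s : B} (hs : s ∈ V) : (p ⁻¹' {s}) ≃ₜ F :=
  have hincl : ∀ z : p ⁻¹' {s}, (z : E) ∈ p ⁻¹' V := fun z ↦ by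
    have hz : p z = s := z.2
    show p z ∈ V
    rw [hz]; exact hs
  have hfst : ∀ z : p ⁻¹' {s}, (φ.symm ⟨z, hincl z⟩).1 = ⟨s, hs⟩ := fun z ↦
    Subtype.ext (by rw [← hφ (φ.symm ⟨z, hincl z⟩), Homeomorph.apply_symm_apply]; exact z.2)
  have hmem : ∀ y : F, ((φ (⟨s, hs⟩, y) : p ⁻¹' V) : E) ∈ p ⁻¹' {s} := fun y ↦ by
    show p _ = s
    rw [hφ]
  { toFun := fun z ↦ (φ.symm ⟨z, hincl z⟩).2
    invFun := fun y ↦ ⟨(φ (⟨s, hs⟩, y) : p ⁻¹' V), hmem y⟩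
    left_inv := fun z ↦ by
      apply Subtype.ext
      have hpair : ((⟨s, hs⟩ : V), (φ.symm ⟨z, hincl z⟩).2) = φ.symm ⟨z, hincl z⟩ :=
        Prod.ext (hfst z).symm rfl
      show ((φ (⟨s, hs⟩, (φ.symm ⟨z, hincl z⟩).2) : p ⁻¹' V) : E) = z
      rw [hpair, Homeomorph.apply_symm_apply]
    right_inv := fun y ↦ by
      have hι : (⟨((φ (⟨s, hs⟩, y) : p ⁻¹' V) : E), hincl ⟨_, hmem y⟩⟩ : p ⁻¹' V) = φ (⟨s, hs⟩, y) :=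
        Subtype.ext rfl
      show (φ.symm ⟨((φ (⟨s, hs⟩, y) : p ⁻¹' V) : E), hincl ⟨_, hmem y⟩⟩).2 = y
      rw [hι, Homeomorph.symm_apply_apply]
    continuous_toFun := (continuous_snd.comp φ.symm.continuous).comp (continuous_subtype_val.subtype_mk _)
    continuous_invFun := (continuous_subtype_val.comp
      (φ.continuous.comp (continuous_const.prodMk continuous_id))).subtype_mk _ }

end Literature.AlgebraicGeometry.Motives

namespace Literature.AlgebraicGeometry.HodgeTheory

open Literature.AlgebraicGeometry.Motives

/-! ### The reduction -/

/-- **The named fact reduced to smoothness of `π` near the smooth fibres.** Let `X` be a smooth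
projective complex variety and `ι : X ⟶ ℙᴺ_ℂ`, with universal hyperplane section
`π : 𝒳 ⟶ (ℙᴺ)^*` and locus `U ⊆ (ℙᴺ)^*(ℂ)` of smooth `n`-dimensional hyperplane sections. Suppose
that every `t ∈ U` has a Zariski-open neighbourhood `V₀ ⊆ (ℙᴺ)^*` over which `π` is smooth of
relative dimension `n` ("by the definition of `U`, the map `φ = pr₂` is a submersion with smooth
fibre `X_H` over `H`", Voisin II §3.2.2, in scheme-theoretic form). Then the monodromy package
`UniversalHyperplaneSectionLocalSystem N ι n` exists. Proof: by Ehresmann's theorem on complex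
points (`Motives.exists_trivialisation_of_smoothOfRelativeDimension_morphismRestrict`, Voisin I
Thm. 9.3) `π(ℂ)` is trivial, `V × F ≃ π(ℂ)⁻¹V`, over an open `V ∋ t` inside `V₀(ℂ)`; every
`s ∈ V` lies in `U` — the fibre `X_s` is smooth of relative dimension `n` (base change),
projective (a closed subscheme of the projective `𝒳`) and geometrically irreducible, because
`X_s(ℂ) ≃ F ≃ X_t(ℂ)` is connected (`connectedSpace_complexPoints` for the smooth projective
`X_t`; `geometricallyIrreducible_of_connectedSpace_complexPoints`) — so `U` is open and
`nonempty_universalHyperplaneSectionLocalSystem_of_trivialisations` applies.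
[cite: VoisinHodgeII2003, §3.2.2] [cite: VoisinHodgeI2002, Thm. 9.3 and §9.2.1] -/
theorem nonempty_universalHyperplaneSectionLocalSystem_of_smoothOfRelativeDimension_morphismRestrict
    (N n : ℕ) {X : Motives.SchemeOver ℂ} {d : ℕ} (hX : Motives.IsSmoothProjective d X)
    (ι : X ⟶ Motives.projectiveSpace N ℂ)
    (hsm : ∀ ⦃t⦄, t ∈ universalSmoothLocus N ι n →
      ∃ V₀ : (Motives.dualProjectiveSpace N ℂ).left.Opens, t.pt ∈ V₀ ∧
        SmoothOfRelativeDimension n ((Motives.UniversalHyperplaneSection.proj N ι).left ∣_ V₀)) :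
    Nonempty (UniversalHyperplaneSectionLocalSystem N ι n) := by
  haveI : IsProper X.hom := Motives.IsSmoothProjective.isProper_holds hX
  haveI : IsProper (Motives.UniversalHyperplaneSection.proj N ι).left :=
    Motives.UniversalHyperplaneSection.isProper_proj_left N ι
  haveI : IsSeparated (Motives.universalHyperplaneSection N ι).hom :=
    isSeparated_universalHyperplaneSection_hom N ι
  have hSsp : Motives.IsSmoothProjective N (Motives.dualProjectiveSpace N ℂ) :=
    Motives.isSmoothProjective_projectiveSpace_holds ℂ N
  haveI : SmoothOfRelativeDimension N (Motives.dualProjectiveSpace N ℂ).hom := hSsp.smoothOfRelativeDimension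
  haveI : IsProper (Motives.dualProjectiveSpace N ℂ).hom := Motives.IsSmoothProjective.isProper_holds hSsp
  haveI : Smooth (Motives.dualProjectiveSpace N ℂ).hom := SmoothOfRelativeDimension.smooth N _
  -- second countability of `𝒳(ℂ)` and `(ℙᴺ)^*(ℂ)` (both of finite type)
  have h𝒳hom : (Motives.universalHyperplaneSection N ι).hom =
      (Motives.UniversalHyperplaneSection.proj N ι).left ≫ (Motives.dualProjectiveSpace N ℂ).hom :=
    (Over.w (Motives.UniversalHyperplaneSection.proj N ι)).symm
  haveI : IsProper (Motives.universalHyperplaneSection N ι).hom := by rw [h𝒳hom]; infer_instance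
  haveI : CompactSpace (Motives.dualProjectiveSpace N ℂ).left :=
    QuasiCompact.compactSpace_of_compactSpace (Motives.dualProjectiveSpace N ℂ).hom
  haveI : CompactSpace (Motives.universalHyperplaneSection N ι).left :=
    QuasiCompact.compactSpace_of_compactSpace (Motives.universalHyperplaneSection N ι).hom
  haveI : SecondCountableTopology (Motives.ComplexPoints (Motives.universalHyperplaneSection N ι)) :=
    Motives.ComplexPoints.secondCountableTopology_of_compactSpace_holds _
  haveI : SecondCountableTopology (Motives.ComplexPoints (Motives.dualProjectiveSpace N ℂ)) :=
    Motives.ComplexPoints.secondCountableTopology_of_compactSpace_holds _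
  have h𝒳proj : Motives.IsProjectiveOver (Motives.universalHyperplaneSection N ι) :=
    Motives.UniversalHyperplaneSection.isProjectiveOver N ι hX.isProjectiveOver
  -- the key step: a trivialising neighbourhood inside `U`
  have key : ∀ ⦃t⦄, t ∈ universalSmoothLocus N ι n →
      ∃ V : Set (Motives.ComplexPoints (Motives.dualProjectiveSpace N ℂ)),
        IsOpen V ∧ t ∈ V ∧ V ⊆ universalSmoothLocus N ι n ∧
        ∃ (F : Type) (_ : TopologicalSpace F)
          (φ : V × F ≃ₜ tubeOver (Motives.UniversalHyperplaneSection.proj N ι) V),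
          ∀ x, Motives.AlgPoints.map (Motives.UniversalHyperplaneSection.proj N ι)
            (φ x : Motives.ComplexPoints (Motives.universalHyperplaneSection N ι)) = (x.1 : _) := by
    intro t ht
    obtain ⟨V₀, htV₀, hV₀⟩ := hsm ht
    obtain ⟨V, hVo, htV, hVV₀, F, _, φ, hφ⟩ :=
      Motives.exists_trivialisation_of_smoothOfRelativeDimension_morphismRestrict
        (Motives.UniversalHyperplaneSection.proj N ι) V₀ n N t htV₀
    refine ⟨V, hVo, htV, fun s hs ↦ ?_, F, inferInstance, φ, hφ⟩
    -- `s ∈ U`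
    have hsV₀ : s.pt ∈ V₀ := hVV₀ hs
    haveI hsm_s : SmoothOfRelativeDimension n
        (Motives.fiberOver (Motives.UniversalHyperplaneSection.proj N ι) s).hom :=
      smoothOfRelativeDimension_fiberOver_hom _ V₀ s hsV₀
    -- `X_s(ℂ) ≃ F ≃ X_t(ℂ)` is connected
    haveI : ConnectedSpace (Motives.ComplexPoints
        (Motives.fiberOver (Motives.UniversalHyperplaneSection.proj N ι) t)) :=
      connectedSpace_complexPoints ht
    have e_t : Motives.ComplexPoints (Motives.fiberOver (Motives.UniversalHyperplaneSection.proj N ι) t) ≃ₜ F :=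
      (fiberHomeomorph _ t).trans (fibreHomeomorphOfTrivialisation φ hφ htV)
    have e_s : Motives.ComplexPoints (Motives.fiberOver (Motives.UniversalHyperplaneSection.proj N ι) s) ≃ₜ F :=
      (fiberHomeomorph _ s).trans (fibreHomeomorphOfTrivialisation φ hφ hs)
    haveI : ConnectedSpace (Motives.ComplexPoints
        (Motives.fiberOver (Motives.UniversalHyperplaneSection.proj N ι) s)) :=
      (e_t.trans e_s.symm).surjective.connectedSpace (e_t.trans e_s.symm).continuous
    exact ⟨hsm_s, isProjectiveOver_fiberOver _ h𝒳proj s,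
      geometricallyIrreducible_of_connectedSpace_complexPoints n⟩
  have hUo : IsOpen (universalSmoothLocus N ι n) := by
    rw [isOpen_iff_forall_mem_open]
    intro t ht
    obtain ⟨V, hVo, htV, hVU, -⟩ := key ht
    exact ⟨V, hVU, hVo, htV⟩
  exact nonempty_universalHyperplaneSectionLocalSystem_of_trivialisations N n ι hUo
    fun t ht ↦ key ht

end Literature.AlgebraicGeometry.HodgeTheory

end
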